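/-
Copyright (c) 2026 the pub-hodgecm-mathlib formalisation cell (harness21).  Prover seat hodgecm-mathlib-K2Liu-p12 (g6), Track B «K2-LIT»,
#184♮ = hLiu418 = `stmt-HodgeConjecture-24832`; #42S block D, row D-2, (σ-A) mini-road (LEAD F0P6-plan (g15) RULING M-160f; (σ-A) road desk K2Liu-p25 (g3)
WORD #5 (2) ∕ WORD #6 «K2Liu-p12 pens (an-2)»), brick [A4-an] (an-2) «THE ζ-STAGE IS A FOURIER INVERSION ALONG `t ↦ h(t,s)`».  THEOREMS ONLY (no `def`,
no `instance`, no `notation`, no named-fact hypothesis, no `sorry`).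
-/
import Summits.HodgeConjecture.HodgeConjecture.Theorems.K2LiuLocalPiPartialFourierSplitting   -- ★ p864180 [A2] OF RECORD (K2Liu-p23): `((𝓕 ⊠ 1) Θ)(η ⊔ b) = ∫ …`
import Summits.HodgeConjecture.HodgeConjecture.Theorems.K2LiuLocalPiGlueFubini               -- ★ p864190 (this seat): `dotProduct_glue_zero_right`, Fubini, slices
import Summits.HodgeConjecture.HodgeConjecture.Theorems.K2LiuSchwartzBruhatFiberIntegral     -- ★ fibre integrals of 𝒮 are 𝒮
import Literature.RepresentationTheory.HeisenbergGroup.SchrodingerPiOperators               -- ★ Rao `fourierOpPi`, `normAbs_det_pos`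
import Literature.NumberTheory.Weil1964.LocalLinearChangeOfVariables                        -- ★ `integral_comp_linearEquiv`
import HarnessLib

/-!
# Crux `HLiu418`, socket #42S block D (row D-2, (σ-A) mini-road), brick (an-2) `K2LiuCornerZetaStageInversion`:
# THE ζ-INTEGRAL OF A FOURIER TRANSFORM ALONG THE GRAPH `ζ ↦ ζ·s` IS THE INTEGRAL OVER THE KERNEL HYPERPLANE `{t | h(t,s) = 0}`

Cell `hodgecm-mathlib`, crux item hLiu418 = `stmt-HodgeConjecture-24832`; squad K2 ∕ K2Liu, road `K2_Liu`, socket #42S; (σ-A) mini-road of RULING M-160f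
([A1] ★ p864240 · [A1-mat] ★ p864192∕p864250 · [A1-ζ] F0P2-p07 · [A2] ★ p864180 (+ ★ p864190) · [A3] ★ p864232 · [A4-alg] K2Liu-p08 · [A4-an] = (an-1) the null-cone
Radon measure, **(an-2) THIS FILE**, (an-3) the assembly).  Lane `--supports stmt-HodgeConjecture-24832 --as helper` (count-neutral helper; closes no socket).

THE MECHANISM.  In the rank-one stage chain of ★ `K2LiuRankOneStagePlaceLetterValues` the ζ-stage is `N₂ = L⁻¹ ∫_{ζ ∈ E_w} N₁(φ(w₁)·φ(u₋(ζ))·g) dμ_w(ζ)`; after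
[A1]'s y-stage normal form (the cone variable `s` in one block, evaluation at `0` in the other) and [A1-ζ]'s Levi words (`w₁` swaps the two blocks, `u₋(ζ)` shears),
the vector is read at the GRAPH `(ζ·s) ⊔ s`, and the x-stage's `φ(w₂)` supplies the partial Fourier transform `𝓕_{X₁} ⊠ 1` ([A2]) on a position function
`Θ`: the ζ-integrand is `((𝓕_{X₁} ⊠ 1) Θ)((ζ·s) ⊔ s) = ∫_t ψ(⟨t, ζ·s⟩) Θ(t ⊔ s) dt`.  Since `ζ ↦ ⟨t, ζ·s⟩` is the trace pairing of `E_w` against the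
`E_w`-LINEAR SURJECTION `λ_s : t ↦ h(t,s)` (`s ≠ 0`), the ζ-integral is a FOURIER INVERSION ALONG `λ_s` and lands on the kernel hyperplane `s^⊥ = {h(t,s) = 0}`
— the `t`-fibre of K2Liu-p08's incidence variety `Z° = {s ≠ 0, Q s = 0, h(s,t) = 0}` (NOT the line `E·s`: that would be the graph read in the position slot).
THIS FILE is the [A1]-FREE analytic engine, in Rao's product-Haar currency `μ^ι := Measure.pi fun _ => μ` (`μ` a Haar measure on `F`):
DATA — finite types `κ` (the ζ-block; `E_w ≅ F²` at use), `ι₁` (the transformed block `X₁ ≅ V′_w`), `ι₂` with an ADAPTED SPLITTING `eA : κ ⊕ ι₂ ≃ ι₁`; a linear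
map `Z : (κ → F) →ₗ[F] (ι₁ → F)` (ζ ↦ the Schrödinger coordinates of `ζ·s`) and an ADAPTED FRAME `A : (ι₁ → F) ≃ₗ[F] (ι₁ → F)` tied to `Z` by the ONE letter
`hA : ∀ t ζ, A t ⬝ᵥ Z ζ = resL eA t ⬝ᵥ ζ` («`Zᵀ ∘ A` is the projection onto the `κ`-block»; for `λ_s = h(·,s)` the Witt frame `s′ ⊕ (E s ⊕ L_s)` of
★ [A4-alg] `K2LiuIsotropicOrthogonalNormClass` is such an `A`, and `A({0} × F^{ι₂}) = ker Zᵀ = s^⊥`).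
* §1 THE FIBRE INTEGRAL `Φ_A(a) := ∫ G(A(a ⊔ b)) dμ^{ι₂}(b)` of `G ∈ 𝒮(F^{ι₁})` along `λ_s` is Schwartz–Bruhat on `F^κ` (★ `K2LiuSchwartzBruhatFiberIntegral`);
* §2 **`piFourierSB_apply_linear_eq`** — `𝓕G(Z ζ) = |det A| · 𝓕Φ_A(ζ)` (change of variables ★ `integral_comp_linearEquiv`, the letter `hA`, Fubini ★ p864190 and
  `(a ⊔ b) ⬝ᵥ (ζ ⊔ 0) = a ⬝ᵥ ζ`); hence `ζ ↦ 𝓕G(Z ζ)` is Schwartz–Bruhat, INTEGRABLE ((an-3)'s Fubini letter);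
* §3 **MAIN `integral_piFourierSB_comp_linear_eq : ∫ 𝓕G(Z ζ) dμ^κ(ζ) = c_κ · |det A| · ∫ G(A(0 ⊔ b)) dμ^{ι₂}(b)`**, `c_κ = piSelfDualConst F κ μ^κ m` — Fourier inversion
  ★ `piFourierSB_piFourierSB_eq` at `0`: «THE ζ-INTEGRAL OF THE FOURIER TRANSFORM ALONG THE GRAPH IS THE INTEGRAL OVER THE KERNEL HYPERPLANE»; the unfolded twin;
* §4 **DOCKING `integral_partialFourier_graph_eq`** (two-block model `e : ι₁ ⊕ ι₁′ ≃ ι`, `Θ ∈ 𝒮(F^ι)`, position slot frozen at `x₂`; keyed BY NAME on [A2] OF RECORD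
  ★ p864180 `coe_boxEquivSB_fourierOpPi_refl_apply_glue`):  `∫ ((𝓕_{ι₁} ⊠ 1) Θ)((Z ζ) ⊔ x₂) dμ^κ(ζ) = c_κ · |det A| · ∫ Θ(A(0 ⊔ b) ⊔ x₂) dμ^{ι₂}(b)` — the
  ζ-STAGE ENGINE: (an-3) feeds `Θ := ψ(x·Q)·Ξ_h` ([A1] + [A1-ζ] words), `x₂ := s`, and reads the right-hand side as the `t ∈ s^⊥` fibre of `Z°` against `σ_cone(ds)` ((an-1)).
The shear-slot convention of `u₋(ζ)` ([A1-ζ]) only changes `Z`; the engine is agnostic.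
[cite: WeilBNT1967, Chap. VII §2, Prop. 2 and Cor. 1] [cite: WeilBNT1967, Chap. I §2, Th. 3 Cor. 3] [cite: Weil1964, n° 11] [cite: KudlaRallis1994, §2 (2.10)–(2.12)]
[cite: MoeglinVignerasWaldspurger1987, Chap. 2 II.6]
HONEST LABEL.  Count-neutral helper; it retires nothing by itself: `HC_CM` is proved only modulo the 7 printed citations (2 remaining named inputs:
hLiu418 = `stmt-HodgeConjecture-24832`, h413 = `stmt-HodgeConjecture-24833`) until rung 0 closes; `hcone`∕`hZ` stay BY VALUE (R2) until (an-1)–(an-3) land.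

## References
* [WeilBNT1967] A. Weil, *Basic Number Theory* (1967), Chap. I §2 Th. 3 Cor. 3 (module of a linear automorphism), Chap. VII §2 Prop. 2, Cor. 1 (standard
  functions, Fourier inversion with the self-duality constant).
* [Weil1964] A. Weil, *Sur certains groupes d'opérateurs unitaires*, Acta Math. 111 (1964), n° 11 (Fourier transform on `𝒮(G)`, partial integration).
* [KudlaRallis1994] S. Kudla, S. Rallis, *A regularized Siegel–Weil formula: the first term identity*, Ann. of Math. 140 (1994), §2 (2.10)–(2.12) (the rank-one
  coefficient as an integral over `{Q(t) = σ}` fibres).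
* [MoeglinVignerasWaldspurger1987] C. Mœglin, M.-F. Vignéras, J.-L. Waldspurger, LNM 1291 (1987), Chap. 2 II.6 (partial Fourier transforms).
-/

set_option autoImplicit false
set_option linter.dupNamespace false -- the mandated namespace repeats `HodgeConjecture.HodgeConjecture`

noncomputable section

open MeasureTheory
open scoped Matrix NNReal
open Literature.NumberTheory.Automorphic
open Literature.NumberTheory.GaloisRepresentations Literature.NumberTheory.GaloisRepresentations.IsNonarchimedeanLocalField
open Literature.RepresentationTheory.HeisenbergGroup
open Literature.NumberTheory.Weil1964
open Summit.HodgeConjecture.HodgeConjecture.Cruxes.HLiu418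

namespace Summit.HodgeConjecture.HodgeConjecture.Cruxes.HLiu418.K2LiuCornerZetaStageInversion

variable {F : Type*} [Field F] [ValuativeRel F] [TopologicalSpace F] [IsNonarchimedeanLocalField F]
  {κ ι₂ ι₁ : Type*} [Fintype κ] [Fintype ι₂] [Fintype ι₁] (eA : κ ⊕ ι₂ ≃ ι₁)
  (Z : (κ → F) →ₗ[F] (ι₁ → F)) (A : (ι₁ → F) ≃ₗ[F] (ι₁ → F))

/-! ## §1 The fibre integral of `G` along the adapted frame is Schwartz–Bruhat -/

section Fibre

omit [Fintype κ] [Fintype ι₂] in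
/-- `(a, b) ↦ G(A(a ⊔ b))` is Schwartz–Bruhat on `F^κ × F^{ι₂}` for `G ∈ 𝒮(F^{ι₁})`: the map `(a, b) ↦ A(a ⊔ b)` is a homeomorphism.
[cite: Weil1964, n° 11] -/
theorem comp_frame_glue_mem_schwartzBruhat {G : (ι₁ → F) → ℂ} (hG : G ∈ SchwartzBruhat (ι₁ → F)) :
    (fun p : (κ → F) × (ι₂ → F) => G (A (glue eA p.1 p.2))) ∈ SchwartzBruhat ((κ → F) × (ι₂ → F)) := by
  have hAc : Continuous (A : (ι₁ → F) → (ι₁ → F)) := LinearMap.continuous_on_pi (A : (ι₁ → F) →ₗ[F] (ι₁ → F))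
  have hAsc : Continuous (A.symm : (ι₁ → F) → (ι₁ → F)) := LinearMap.continuous_on_pi (A.symm : (ι₁ → F) →ₗ[F] (ι₁ → F))
  let Φ : (κ → F) × (ι₂ → F) ≃ₜ (ι₁ → F) :=
    { toFun := fun p => A (glue eA p.1 p.2)
      invFun := fun v => (resL eA (A.symm v), resR eA (A.symm v))
      left_inv := fun p => by simp only [LinearEquiv.symm_apply_apply, resL_glue, resR_glue]
      right_inv := fun v => by simp only [glue_resL_resR, LinearEquiv.apply_symm_apply]
      continuous_toFun := hAc.comp (continuous_glue eA)
      continuous_invFun := ((continuous_resL eA).comp hAsc).prodMk ((continuous_resR eA).comp hAsc) }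
  exact K2LiuSchwartzBruhatFiberIntegral.comp_homeomorph_mem_schwartzBruhat Φ hG

/-- `G ∘ A` is Schwartz–Bruhat for a linear automorphism `A` of `F^{ι₁}`. [cite: Weil1964, n° 11] -/
theorem comp_linearEquiv_mem_schwartzBruhat {G : (ι₁ → F) → ℂ} (hG : G ∈ SchwartzBruhat (ι₁ → F)) :
    (fun v : ι₁ → F => G (A v)) ∈ SchwartzBruhat (ι₁ → F) := by
  have hAc : Continuous (A : (ι₁ → F) → (ι₁ → F)) := LinearMap.continuous_on_pi (A : (ι₁ → F) →ₗ[F] (ι₁ → F))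
  have hAsc : Continuous (A.symm : (ι₁ → F) → (ι₁ → F)) := LinearMap.continuous_on_pi (A.symm : (ι₁ → F) →ₗ[F] (ι₁ → F))
  let Ψ : (ι₁ → F) ≃ₜ (ι₁ → F) :=
    { toFun := A, invFun := A.symm, left_inv := A.symm_apply_apply, right_inv := A.apply_symm_apply,
      continuous_toFun := hAc, continuous_invFun := hAsc }
  exact K2LiuSchwartzBruhatFiberIntegral.comp_homeomorph_mem_schwartzBruhat Ψ hG

variable [MeasurableSpace F] (μ : Measure F)

omit [Fintype κ] in
/-- **THE FIBRE INTEGRAL `Φ_A(a) := ∫ G(A(a ⊔ b)) dμ^{ι₂}(b)` IS SCHWARTZ–BRUHAT ON `F^κ`** (★ `integral_prod_right_mem_schwartzBruhat`: fibre integrals of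
Schwartz–Bruhat functions are Schwartz–Bruhat).  For `Zᵀ ∘ A = pr_κ` this is the push-forward of `G·dμ^{ι₁}` under `λ = Zᵀ`, up to `|det A|`.
[cite: Weil1964, n° 11] [cite: WeilBNT1967, Chap. VII §2, Prop. 2] -/
theorem integral_comp_frame_glue_mem_schwartzBruhat {G : (ι₁ → F) → ℂ} (hG : G ∈ SchwartzBruhat (ι₁ → F)) :
    (fun a : κ → F => ∫ b, G (A (glue eA a b)) ∂(Measure.pi fun _ : ι₂ => μ)) ∈ SchwartzBruhat (κ → F) := by
  haveI : T2Space F := (isLocalField F).toT2Space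
  exact K2LiuSchwartzBruhatFiberIntegral.integral_prod_right_mem_schwartzBruhat (Measure.pi fun _ : ι₂ => μ)
    (comp_frame_glue_mem_schwartzBruhat eA A hG)

end Fibre

/-! ## §2 The Fourier transform read along `Z`: `𝓕G(Z ζ) = |det A| · 𝓕Φ_A(ζ)` -/

section Along

variable [MeasurableSpace F] [BorelSpace F] (μ : Measure F) [μ.IsAddHaarMeasure]
  {ψ : AddChar F Circle} (hψ : ψ.IsContinuousNontrivial)

omit [ValuativeRel F] [TopologicalSpace F] [IsNonarchimedeanLocalField F] [MeasurableSpace F] [BorelSpace F] in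
/-- the pairing against `ζ ⊔ 0` only sees the `κ`-block: `v ⬝ᵥ (ζ ⊔ 0) = v|κ ⬝ᵥ ζ`. [cite: WeilBNT1967, Chap. VII §2, Prop. 2] -/
theorem dotProduct_glue_zero_eq_resL_dotProduct (v : ι₁ → F) (ζ : κ → F) : v ⬝ᵥ glue eA ζ 0 = resL eA v ⬝ᵥ ζ := by
  conv_lhs => rw [← glue_resL_resR eA v]
  rw [K2LiuLocalPiGlueFubini.dotProduct_glue_zero_right]

include hψ in
/-- **the Fourier integral after the adapted change of variables is the Fourier transform of the fibre integral**:
`∫ ψ(v|κ ⬝ᵥ ζ) G(A v) dμ^{ι₁}(v) = 𝓕Φ_A(ζ)` (Fubini along `eA`, ★ p864190, and `(a ⊔ b) ⬝ᵥ (ζ ⊔ 0) = a ⬝ᵥ ζ`). [cite: WeilBNT1967, Chap. VII §2, Prop. 2] -/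
theorem integral_addChar_resL_mul_comp_frame_eq_piFourierSB_fibre {G : (ι₁ → F) → ℂ} (hG : G ∈ SchwartzBruhat (ι₁ → F)) (ζ : κ → F) :
    ∫ v, ((ψ (resL eA v ⬝ᵥ ζ) : Circle) : ℂ) * G (A v) ∂(Measure.pi fun _ : ι₁ => μ) =
      piFourierSB ψ (Measure.pi fun _ : κ => μ) (fun a : κ → F => ∫ b, G (A (glue eA a b)) ∂(Measure.pi fun _ : ι₂ => μ)) ζ := by
  -- the integrand is the `(ζ ⊔ 0)`-modulation of the Schwartz–Bruhat function `G ∘ A`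
  have hGA : (fun v : ι₁ → F => G (A v)) ∈ SchwartzBruhat (ι₁ → F) := comp_linearEquiv_mem_schwartzBruhat A hG
  have hmod : (fun v : ι₁ → F => ((ψ (dotProductBilin F F v (glue eA ζ 0)) : Circle) : ℂ) * G (A v)) ∈ SchwartzBruhat (ι₁ → F) :=
    modulation_mul_mem_schwartzBruhat (dotProductBilin F F) ψ (isLocallyConstant_of_isContinuousNontrivial hψ)
      continuous_dotProductBilin_left (glue eA ζ 0) hGA
  have hrw : (fun v : ι₁ → F => ((ψ (resL eA v ⬝ᵥ ζ) : Circle) : ℂ) * G (A v)) =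
      fun v => ((ψ (dotProductBilin F F v (glue eA ζ 0)) : Circle) : ℂ) * G (A v) := by
    funext v
    rw [dotProductBilin_apply_apply, dotProduct_glue_zero_eq_resL_dotProduct]
  rw [hrw, K2LiuLocalPiGlueFubini.integral_pi_schwartzBruhat_eq_integral_integral_glue F eA μ hmod, piFourierSB_apply]
  refine integral_congr_ae (Filter.Eventually.of_forall fun a => ?_)
  simp only [dotProductBilin_apply_apply, K2LiuLocalPiGlueFubini.dotProduct_glue_zero_right]
  rw [integral_const_mul]

include hψ in
/-- **`𝓕G(Z ζ) = |det A| · 𝓕Φ_A(ζ)`** — the Fourier transform of `G ∈ 𝒮(F^{ι₁})` at the point `Z ζ` of the graph is `|det A|` times the Fourier transform on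
`F^κ` of the fibre integral `Φ_A`, by the substitution `t = A v` (★ `integral_comp_linearEquiv`: `∫ φ(A v) = |det A|⁻¹ ∫ φ`), the frame letter `hA`
(`A v ⬝ᵥ Z ζ = v|κ ⬝ᵥ ζ`) and the previous lemma. [cite: WeilBNT1967, Chap. I §2, Th. 3 Cor. 3] [cite: WeilBNT1967, Chap. VII §2, Prop. 2] -/
theorem piFourierSB_apply_linear_eq (hA : ∀ (t : ι₁ → F) (ζ : κ → F), A t ⬝ᵥ Z ζ = resL eA t ⬝ᵥ ζ)
    {G : (ι₁ → F) → ℂ} (hG : G ∈ SchwartzBruhat (ι₁ → F)) (ζ : κ → F) :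
    piFourierSB ψ (Measure.pi fun _ : ι₁ => μ) G (Z ζ) =
      (normAbs F (LinearMap.det (A : (ι₁ → F) →ₗ[F] (ι₁ → F))) : ℂ) *
        piFourierSB ψ (Measure.pi fun _ : κ => μ) (fun a : κ → F => ∫ b, G (A (glue eA a b)) ∂(Measure.pi fun _ : ι₂ => μ)) ζ := by
  set φ : (ι₁ → F) → ℂ := fun t => ((ψ (t ⬝ᵥ Z ζ) : Circle) : ℂ) * G t with hφ
  have hc : (normAbs F (LinearMap.det (A : (ι₁ → F) →ₗ[F] (ι₁ → F))) : ℝ) ≠ 0 := (normAbs_det_pos A).ne'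
  -- substitution `t = A v`
  have h2 := integral_comp_linearEquiv μ A φ
  have h2' : ∫ t, φ t ∂(Measure.pi fun _ : ι₁ => μ) =
      (normAbs F (LinearMap.det (A : (ι₁ → F) →ₗ[F] (ι₁ → F))) : ℂ) * ∫ v, φ (A v) ∂(Measure.pi fun _ : ι₁ => μ) := by
    have hcc : (normAbs F (LinearMap.det (A : (ι₁ → F) →ₗ[F] (ι₁ → F))) : ℂ) *
        ((((normAbs F (LinearMap.det (A : (ι₁ → F) →ₗ[F] (ι₁ → F)))⁻¹ : ℝ≥0)) : ℝ) : ℂ) = 1 := by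
      rw [map_inv₀, ← Complex.ofReal_mul, ← Complex.ofReal_one]
      congr 1
      simp [hc]
    rw [h2, Complex.real_smul, ← mul_assoc, hcc, one_mul]
  -- the substituted integrand is the `κ`-modulation of `G ∘ A`
  have h1 : ∫ v, φ (A v) ∂(Measure.pi fun _ : ι₁ => μ) = ∫ v, ((ψ (resL eA v ⬝ᵥ ζ) : Circle) : ℂ) * G (A v) ∂(Measure.pi fun _ : ι₁ => μ) := by
    refine integral_congr_ae (Filter.Eventually.of_forall fun v => ?_)
    simp only [hφ, hA]
  rw [piFourierSB_apply, h2', h1, integral_addChar_resL_mul_comp_frame_eq_piFourierSB_fibre eA A μ hψ hG ζ]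

include hψ in
/-- **`ζ ↦ 𝓕G(Z ζ)` is Schwartz–Bruhat on `F^κ`** (it is `|det A| · 𝓕Φ_A`, ★ `piFourierSB_mem_schwartzBruhat`). [cite: WeilBNT1967, Chap. VII §2, Prop. 2] -/
theorem piFourierSB_comp_linear_mem_schwartzBruhat (hA : ∀ (t : ι₁ → F) (ζ : κ → F), A t ⬝ᵥ Z ζ = resL eA t ⬝ᵥ ζ)
    {G : (ι₁ → F) → ℂ} (hG : G ∈ SchwartzBruhat (ι₁ → F)) :
    (fun ζ : κ → F => piFourierSB ψ (Measure.pi fun _ : ι₁ => μ) G (Z ζ)) ∈ SchwartzBruhat (κ → F) := by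
  haveI : SecondCountableTopology F := secondCountableTopology_localField F
  have hrw : (fun ζ : κ → F => piFourierSB ψ (Measure.pi fun _ : ι₁ => μ) G (Z ζ)) =
      fun ζ => (normAbs F (LinearMap.det (A : (ι₁ → F) →ₗ[F] (ι₁ → F))) : ℂ) •
        piFourierSB ψ (Measure.pi fun _ : κ => μ) (fun a : κ → F => ∫ b, G (A (glue eA a b)) ∂(Measure.pi fun _ : ι₂ => μ)) ζ :=
    funext fun ζ => by rw [piFourierSB_apply_linear_eq eA Z A μ hψ hA hG ζ, smul_eq_mul]
  rw [hrw]
  exact Submodule.smul_mem _ _ (piFourierSB_mem_schwartzBruhat (Measure.pi fun _ : κ => μ) hψ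
    (integral_comp_frame_glue_mem_schwartzBruhat eA A μ hG))

include hψ in
/-- **`ζ ↦ 𝓕G(Z ζ)` is integrable on `F^κ`** — (an-3)'s Fubini letter for the ζ-stage. [cite: WeilBNT1967, Chap. VII §2, Prop. 2] -/
theorem integrable_piFourierSB_comp_linear (hA : ∀ (t : ι₁ → F) (ζ : κ → F), A t ⬝ᵥ Z ζ = resL eA t ⬝ᵥ ζ)
    {G : (ι₁ → F) → ℂ} (hG : G ∈ SchwartzBruhat (ι₁ → F)) :
    Integrable (fun ζ : κ → F => piFourierSB ψ (Measure.pi fun _ : ι₁ => μ) G (Z ζ)) (Measure.pi fun _ : κ => μ) := by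
  haveI : SecondCountableTopology F := secondCountableTopology_localField F
  exact integrable_of_mem_schwartzBruhat (Measure.pi fun _ : κ => μ) (piFourierSB_comp_linear_mem_schwartzBruhat eA Z A μ hψ hA hG)

/-! ## §3 MAIN: the ζ-integral of the Fourier transform along the graph is the integral over the kernel hyperplane -/

variable {m : ℤ} (hm : ψ.HasConductorExp m)

include hψ hm in
/-- **FOURIER INVERSION ALONG A LINEAR SURJECTION.**  For `G ∈ 𝒮(F^{ι₁})`, a linear `Z : F^κ → F^{ι₁}` and an adapted frame `A` with `A t ⬝ᵥ Z ζ = t|κ ⬝ᵥ ζ`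
(`Zᵀ ∘ A = pr_κ`, so `A({0} ⊔ F^{ι₂}) = ker Zᵀ`):
`∫ 𝓕G(Z ζ) dμ^κ(ζ) = c_κ · |det A| · ∫ G(A(0 ⊔ b)) dμ^{ι₂}(b)`, `c_κ = piSelfDualConst F κ μ^κ m` —
the ζ-integral of the Fourier transform along the graph `ζ ↦ Z ζ` is the integral of `G` over the KERNEL HYPERPLANE of `Zᵀ` (Fourier inversion
★ `piFourierSB_piFourierSB_eq` for `Φ_A` at the origin).  At use: `Zᵀ = λ_s : t ↦ h(t,s)`, kernel `= s^⊥`.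
[cite: WeilBNT1967, Chap. VII §2, Cor. 1] [cite: KudlaRallis1994, §2 (2.10)–(2.12)] -/
theorem integral_piFourierSB_comp_linear_eq (hA : ∀ (t : ι₁ → F) (ζ : κ → F), A t ⬝ᵥ Z ζ = resL eA t ⬝ᵥ ζ)
    {G : (ι₁ → F) → ℂ} (hG : G ∈ SchwartzBruhat (ι₁ → F)) :
    ∫ ζ, piFourierSB ψ (Measure.pi fun _ : ι₁ => μ) G (Z ζ) ∂(Measure.pi fun _ : κ => μ) =
      (piSelfDualConst F κ (Measure.pi fun _ : κ => μ) m : ℂ) * (normAbs F (LinearMap.det (A : (ι₁ → F) →ₗ[F] (ι₁ → F))) : ℂ) *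
        ∫ b, G (A (glue eA 0 b)) ∂(Measure.pi fun _ : ι₂ => μ) := by
  haveI : SecondCountableTopology F := secondCountableTopology_localField F
  set ΦA : (κ → F) → ℂ := fun a => ∫ b, G (A (glue eA a b)) ∂(Measure.pi fun _ : ι₂ => μ) with hΦA
  have hΦAmem : ΦA ∈ SchwartzBruhat (κ → F) := integral_comp_frame_glue_mem_schwartzBruhat eA A μ hG
  -- `∫ 𝓕Φ_A dμ^κ = 𝓕𝓕Φ_A(0) = c_κ Φ_A(0)`
  have hinv : ∫ ζ, piFourierSB ψ (Measure.pi fun _ : κ => μ) ΦA ζ ∂(Measure.pi fun _ : κ => μ) =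
      (piSelfDualConst F κ (Measure.pi fun _ : κ => μ) m : ℂ) * ΦA 0 := by
    have h0 : ∫ ζ, piFourierSB ψ (Measure.pi fun _ : κ => μ) ΦA ζ ∂(Measure.pi fun _ : κ => μ) =
        piFourierSB ψ (Measure.pi fun _ : κ => μ) (piFourierSB ψ (Measure.pi fun _ : κ => μ) ΦA) 0 := by
      rw [piFourierSB_apply]
      refine integral_congr_ae (Filter.Eventually.of_forall fun ζ => ?_)
      simp only [dotProduct_zero, AddChar.map_zero_eq_one, Circle.coe_one, one_mul]
    rw [h0, piFourierSB_piFourierSB_eq (Measure.pi fun _ : κ => μ) hψ hm hΦAmem]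
    simp only [neg_zero]
  calc ∫ ζ, piFourierSB ψ (Measure.pi fun _ : ι₁ => μ) G (Z ζ) ∂(Measure.pi fun _ : κ => μ)
      = ∫ ζ, (normAbs F (LinearMap.det (A : (ι₁ → F) →ₗ[F] (ι₁ → F))) : ℂ) * piFourierSB ψ (Measure.pi fun _ : κ => μ) ΦA ζ
          ∂(Measure.pi fun _ : κ => μ) :=
        integral_congr_ae (Filter.Eventually.of_forall fun ζ => piFourierSB_apply_linear_eq eA Z A μ hψ hA hG ζ)
    _ = (normAbs F (LinearMap.det (A : (ι₁ → F) →ₗ[F] (ι₁ → F))) : ℂ) *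
          ((piSelfDualConst F κ (Measure.pi fun _ : κ => μ) m : ℂ) * ΦA 0) := by rw [integral_const_mul, hinv]
    _ = (piSelfDualConst F κ (Measure.pi fun _ : κ => μ) m : ℂ) * (normAbs F (LinearMap.det (A : (ι₁ → F) →ₗ[F] (ι₁ → F))) : ℂ) *
          ∫ b, G (A (glue eA 0 b)) ∂(Measure.pi fun _ : ι₂ => μ) := by rw [hΦA]; ring

include hψ hm in
/-- the same with the Fourier integral unfolded: `∫_ζ ∫_t ψ(t ⬝ᵥ Z ζ) G(t) dμ^{ι₁} dμ^κ = c_κ · |det A| · ∫ G(A(0 ⊔ b)) dμ^{ι₂}(b)`.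
[cite: WeilBNT1967, Chap. VII §2, Cor. 1] -/
theorem integral_integral_addChar_linear_mul_eq (hA : ∀ (t : ι₁ → F) (ζ : κ → F), A t ⬝ᵥ Z ζ = resL eA t ⬝ᵥ ζ)
    {G : (ι₁ → F) → ℂ} (hG : G ∈ SchwartzBruhat (ι₁ → F)) :
    ∫ ζ, ∫ t, ((ψ (t ⬝ᵥ Z ζ) : Circle) : ℂ) * G t ∂(Measure.pi fun _ : ι₁ => μ) ∂(Measure.pi fun _ : κ => μ) =
      (piSelfDualConst F κ (Measure.pi fun _ : κ => μ) m : ℂ) * (normAbs F (LinearMap.det (A : (ι₁ → F) →ₗ[F] (ι₁ → F))) : ℂ) *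
        ∫ b, G (A (glue eA 0 b)) ∂(Measure.pi fun _ : ι₂ => μ) :=
  integral_piFourierSB_comp_linear_eq eA Z A μ hψ hm hA hG

/-! ## §4 Docking: the ζ-stage engine on the two-block Schrödinger model -/

/-- **THE ζ-STAGE ENGINE.**  In the two-block model `F^ι = F^{ι₁} ⊔ F^{ι₁′}` (splitting `e`; `X₁` = the `𝓕`-block, `X₂` = the position block frozen at `x₂`), for every
`Θ ∈ 𝒮(F^ι)`:  `∫ ((𝓕_{ι₁} ⊠ 1) Θ)((Z ζ) ⊔ x₂) dμ^κ(ζ) = c_κ · |det A| · ∫ Θ(A(0 ⊔ b) ⊔ x₂) dμ^{ι₂}(b)` — the ζ-integral of the partial Fourier transform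
([A2] OF RECORD ★ `K2LiuLocalPiPartialFourierSplitting.coe_boxEquivSB_fourierOpPi_refl_apply_glue`, Rao's `fourierOpPi μ ⊠ 1`) read along the graph
`ζ ↦ (ζ·s) ⊔ s` is the integral of the POSITION function over the kernel hyperplane `{h(t,s) = 0} ⊔ {s}` — the `t`-fibre of `Z° = {s ≠ 0, Q s = 0, h(s,t) = 0}`.
[cite: KudlaRallis1994, §2 (2.10)–(2.12)] [cite: MoeglinVignerasWaldspurger1987, Chap. 2 II.6] [cite: WeilBNT1967, Chap. VII §2, Cor. 1] -/
theorem integral_partialFourier_graph_eq {ι₁' ι : Type*} [Fintype ι₁'] [Fintype ι] (e : ι₁ ⊕ ι₁' ≃ ι)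
    (hA : ∀ (t : ι₁ → F) (ζ : κ → F), A t ⬝ᵥ Z ζ = resL eA t ⬝ᵥ ζ) (Θ : SchwartzBruhat (ι → F)) (x₂ : ι₁' → F) :
    ∫ ζ, ((boxEquivSB F e (fourierOpPi (ι := ι₁) μ hψ hm) (LinearEquiv.refl ℂ (SchwartzBruhat (ι₁' → F))) Θ : SchwartzBruhat (ι → F)) :
        (ι → F) → ℂ) (glue e (Z ζ) x₂) ∂(Measure.pi fun _ : κ => μ) =
      (piSelfDualConst F κ (Measure.pi fun _ : κ => μ) m : ℂ) * (normAbs F (LinearMap.det (A : (ι₁ → F) →ₗ[F] (ι₁ → F))) : ℂ) *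
        ∫ b, (Θ : (ι → F) → ℂ) (glue e (A (glue eA 0 b)) x₂) ∂(Measure.pi fun _ : ι₂ => μ) := by
  have hG : (fun t : ι₁ → F => (Θ : (ι → F) → ℂ) (glue e t x₂)) ∈ SchwartzBruhat (ι₁ → F) := sliceL_mem_schwartzBruhat e Θ.2 x₂
  calc ∫ ζ, ((boxEquivSB F e (fourierOpPi (ι := ι₁) μ hψ hm) (LinearEquiv.refl ℂ (SchwartzBruhat (ι₁' → F))) Θ : SchwartzBruhat (ι → F)) :
          (ι → F) → ℂ) (glue e (Z ζ) x₂) ∂(Measure.pi fun _ : κ => μ)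
      = ∫ ζ, piFourierSB ψ (Measure.pi fun _ : ι₁ => μ) (fun t : ι₁ → F => (Θ : (ι → F) → ℂ) (glue e t x₂)) (Z ζ) ∂(Measure.pi fun _ : κ => μ) := by
        refine integral_congr_ae ?_
        filter_upwards with ζ
        rw [K2LiuLocalPiPartialFourierSplitting.coe_boxEquivSB_fourierOpPi_refl_apply_glue F e hψ hm μ Θ (Z ζ) x₂, piFourierSB_apply]
    _ = _ := integral_piFourierSB_comp_linear_eq eA Z A μ hψ hm hA hG

include hψ hm in
/-- the engine with the partial Fourier transform unfolded ([A1]-free form, no operator names):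
`∫_ζ ∫_t ψ(t ⬝ᵥ Z ζ) Θ(t ⊔ x₂) dμ^{ι₁} dμ^κ = c_κ · |det A| · ∫ Θ(A(0 ⊔ b) ⊔ x₂) dμ^{ι₂}(b)`. [cite: KudlaRallis1994, §2 (2.10)–(2.12)] -/
theorem integral_integral_addChar_linear_mul_slice_eq {ι₁' ι : Type*} (e : ι₁ ⊕ ι₁' ≃ ι)
    (hA : ∀ (t : ι₁ → F) (ζ : κ → F), A t ⬝ᵥ Z ζ = resL eA t ⬝ᵥ ζ) {Θ : (ι → F) → ℂ} (hΘ : Θ ∈ SchwartzBruhat (ι → F)) (x₂ : ι₁' → F) :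
    ∫ ζ, ∫ t, ((ψ (t ⬝ᵥ Z ζ) : Circle) : ℂ) * Θ (glue e t x₂) ∂(Measure.pi fun _ : ι₁ => μ) ∂(Measure.pi fun _ : κ => μ) =
      (piSelfDualConst F κ (Measure.pi fun _ : κ => μ) m : ℂ) * (normAbs F (LinearMap.det (A : (ι₁ → F) →ₗ[F] (ι₁ → F))) : ℂ) *
        ∫ b, Θ (glue e (A (glue eA 0 b)) x₂) ∂(Measure.pi fun _ : ι₂ => μ) :=
  integral_piFourierSB_comp_linear_eq eA Z A μ hψ hm hA (sliceL_mem_schwartzBruhat e hΘ x₂)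

end Along

end Summit.HodgeConjecture.HodgeConjecture.Cruxes.HLiu418.K2LiuCornerZetaStageInversion

end
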